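import Literature.NumberTheory.Transcendental.NesterenkoGenericDegree
import Mathlib.RingTheory.Norm.Transitivity
import HarnessLib

/-!
# Towards LNM 1752 Ch. 3 Proposition 4.11, VIII: the generic splitting of the associated form and the norm form

`Literature/NumberTheory/Transcendental/NesterenkoNormForm.lean`. Eighth step of the discharge of
the named fact `NesterenkoPhilippon2001_ch3_prop_4_11` (Nesterenko–Philippon (eds.), LNM 1752
(2001), Ch. 3 Prop. 4.11 = [Nes10, Prop. 1.4]); sequel of `NesterenkoGenericDegree.lean`
(`[𝕃₀ : K'] = D`, the `D` embeddings `σ : 𝕃₀ → Ω` and their points `β_σ`).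

* **Generic splitting** (`gOm_eq_C_mul_prod`): in `Ω[w₀, …, w_m]`,
  `F(u₁, …, u_s; w) = a · ∏_σ (∑ₖ β_{σ,k} wₖ)`, `a = F(u₁, …, u_s; e_j)`: the product divides `g`
  (`prod_linK_embPt_dvd_gOm`), both have degree `D`, and the constant cofactor is read off at
  `w = e_j` (`β_{σ,j} = 1`).
* **The section points are the conjugates of the generic one** (`exists_eq_smul_embPt`,
  `exists_embPt_eq`): every zero `β ∈ Ω^{m+1} ∖ 0` of `𝔭` on the generic hyperplanes is
  proportional to some `β_σ` (its linear form `ℓ_β` is a prime factor of `a ∏_σ ℓ_{β_σ}`), and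
  equal to it when `β_j = 1`; in particular `β_j ≠ 0`.
* **The norm form** of a polynomial `Q` (`normForm`):
  `G = a^q · N_{𝕃₀/K'}(Q(ρ)) ∈ K' = ℚ(U')`, with
  `G = a^q ∏_σ Q(β_σ)` in `Ω` (`algebraMap_normForm`, `Algebra.norm_eq_prod_embeddings`). For a
  form `Q` of degree `q` this is the norm form `a^{deg Q} ∏ₖ Q(β̄⁽ᵏ⁾)` of Prop. 4.11 over the `D`
  points of the generic linear section of `V(𝔭)`.

Definitions here are plumbing with bodies (`Nprod`, `QL0`, `normForm`); no named facts.

## References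

* [NesterenkoPhilippon2001] LNM 1752 (2001), Ch. 3 §4, Prop. 4.4 (p. 38), Prop. 4.11 (pp. 40–41).
* [Nes10] Yu. V. Nesterenko, Proc. Steklov Inst. Math. 218 (1997) 294–331, §1.
* [HodgePedoe1994] W. V. D. Hodge, D. Pedoe, *Methods of Algebraic Geometry* II, Ch. X §8
  (the Cayley form of a variety splits into the linear forms of the points of a generic section).
-/

noncomputable section

open MvPolynomial Module

attribute [local instance] MvPolynomial.gradedAlgebra

namespace Literature.NumberTheory.Transcendental

namespace Nesterenko

variable {m : ℕ}

namespace GSec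

variable (𝒢 : GSec m)

/-! ### The generic splitting `g = a ∏_σ ℓ_{β_σ}` -/

/-- `deg g = D`. [folklore] -/
theorem totalDegree_gOm : 𝒢.gOm.totalDegree = ideg 𝒢.𝔭 (𝒢.s + 1) :=
  𝒢.isHomogeneous_gOm.totalDegree 𝒢.gOm_ne_zero

/-- `N = ∏_σ ℓ_{β_σ} ∈ Ω[w]`. [folklore] -/
def Nprod : MvPolynomial (Fin (m + 1)) 𝒢.Om :=
  ∏ σ : 𝒢.L0 →ₐ[𝒢.Kp] 𝒢.Om, (∑ k, C (𝒢.embPt σ k) * X k)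

/-- `deg N = D` and `N ≠ 0`. [folklore] -/
theorem totalDegree_Nprod : 𝒢.Nprod.totalDegree = ideg 𝒢.𝔭 (𝒢.s + 1) ∧ 𝒢.Nprod ≠ 0 := by
  classical
  have h := totalDegree_prod_linK (K := 𝒢.Om) (Finset.univ.image 𝒢.embPt) (by
    rintro β hβ
    obtain ⟨σ, -, rfl⟩ := Finset.mem_image.mp hβ
    exact 𝒢.embPt_ne_zero σ)
  rw [Finset.prod_image fun σ _ τ _ h => 𝒢.embPt_injective h,
    Finset.card_image_of_injective _ 𝒢.embPt_injective, Finset.card_univ,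
    card_embeddings_eq_ideg] at h
  exact h

/-- `N(e_j) = 1` (all `β_{σ,j} = 1`). [folklore] -/
theorem eval_indicator_Nprod : eval (fun k => if k = 𝒢.j then 1 else 0) 𝒢.Nprod = 1 := by
  rw [Nprod, eval_prod]
  refine Finset.prod_eq_one fun σ _ => ?_
  rw [eval_linK]
  simp [embPt_j]

/-- The algebra map `A → Ω` applied to `a`. [folklore] -/
abbrev aOm : 𝒢.Om := algebraMap (RU 𝒢.s m) 𝒢.Om (aLead 𝒢.s 𝒢.j (chowForm 𝒢.𝔭 (𝒢.s + 1)))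

/-- `a ≠ 0` in `Ω`. [folklore] -/
theorem aOm_ne_zero : 𝒢.aOm ≠ 0 := fun h =>
  aLead_chowForm_ne_zero 𝒢.prime 𝒢.hom 𝒢.rank 𝒢.chart
    (𝒢.algebraMap_A_Om_injective (by rw [map_zero]; exact h))

/-- **Generic splitting of the associated form**: `F(u₁, …, u_s; w) = a ∏_σ (β_σ · w)` in `Ω[w]`,
the product over the `D` embeddings `σ : 𝕃₀ → Ω`.
[cite: NesterenkoPhilippon2001, Ch. 3 Prop. 4.4 (p. 38), Prop. 4.11 (pp. 40–41)] -/
theorem gOm_eq_C_mul_Nprod : 𝒢.gOm = C 𝒢.aOm * 𝒢.Nprod := by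
  obtain ⟨R, hR⟩ := 𝒢.prod_linK_embPt_dvd_gOm
  change 𝒢.gOm = 𝒢.Nprod * R at hR
  have hN := 𝒢.totalDegree_Nprod
  have hR0 : R ≠ 0 := by rintro rfl; exact 𝒢.gOm_ne_zero (by rw [hR, mul_zero])
  have hdeg : R.totalDegree = 0 := by
    have h1 := totalDegree_mul_of_isDomain hN.2 hR0
    rw [← hR, totalDegree_gOm, hN.1] at h1
    omega
  rw [totalDegree_eq_zero_iff_eq_C] at hdeg
  have hc : coeff 0 R = 𝒢.aOm := by
    have h := 𝒢.eval_indicator_gOm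
    rw [hR, eval_mul, eval_indicator_Nprod, one_mul, hdeg, eval_C] at h
    exact h
  rw [hR, hdeg, hc, mul_comm]

/-! ### The section points are the conjugates `β_σ` -/

/-- **Every zero `β ≠ 0` of `𝔭` on the generic hyperplanes (over `Ω`) is proportional to some `β_σ`**:
its linear form is a prime factor of `a ∏_σ ℓ_{β_σ}`.
[cite: NesterenkoPhilippon2001, Ch. 3 Prop. 4.11 (pp. 40–41)] -/
theorem exists_eq_smul_embPt {β : Fin (m + 1) → 𝒢.Om} (hβ0 : β ≠ 0)
    (hβI : ∀ P ∈ 𝒢.𝔭, aeval β P = 0)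
    (hL : ∀ i : Fin 𝒢.s, ∑ k : Fin (m + 1), algebraMap (RU 𝒢.s m) 𝒢.Om (X (i, k)) * β k = 0) :
    ∃ (σ : 𝒢.L0 →ₐ[𝒢.Kp] 𝒢.Om) (c : 𝒢.Om), β = c • 𝒢.embPt σ := by
  classical
  have hdvd := 𝒢.linK_dvd_gOm hβ0 hβI hL
  rw [gOm_eq_C_mul_Nprod] at hdvd
  have hp := prime_linK hβ0
  have h1 : ((∑ k, C (β k) * X k) : MvPolynomial (Fin (m + 1)) 𝒢.Om) ∣ 𝒢.Nprod := by
    rcases hp.dvd_or_dvd hdvd with h | h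
    · exact absurd (isUnit_of_dvd_unit h ((isUnit_iff_ne_zero.mpr 𝒢.aOm_ne_zero).map C))
        hp.not_unit
    · exact h
  obtain ⟨σ, -, hσ⟩ := (hp.dvd_finsetProd_iff _).mp h1
  obtain ⟨c, hc⟩ := eq_smul_of_linK_dvd_linK hβ0 (𝒢.embPt_ne_zero σ) hσ
  -- `β_σ = c • β` with `c ≠ 0`, so `β = c⁻¹ • β_σ`
  have hc0 : c ≠ 0 := by
    rintro rfl
    rw [zero_smul] at hc
    exact 𝒢.embPt_ne_zero σ hc
  refine ⟨σ, c⁻¹, ?_⟩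
  rw [hc, smul_smul, inv_mul_cancel₀ hc0, one_smul]

/-- Hence such a `β` has `β_j ≠ 0`. [folklore] -/
theorem apply_j_ne_zero {β : Fin (m + 1) → 𝒢.Om} (hβ0 : β ≠ 0)
    (hβI : ∀ P ∈ 𝒢.𝔭, aeval β P = 0)
    (hL : ∀ i : Fin 𝒢.s, ∑ k : Fin (m + 1), algebraMap (RU 𝒢.s m) 𝒢.Om (X (i, k)) * β k = 0) :
    β 𝒢.j ≠ 0 := by
  obtain ⟨σ, c, hc⟩ := 𝒢.exists_eq_smul_embPt hβ0 hβI hL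
  have hc0 : c ≠ 0 := by rintro rfl; exact hβ0 (by rw [hc, zero_smul])
  rw [hc, Pi.smul_apply, embPt_j, smul_eq_mul, mul_one]
  exact hc0

/-- **A zero of `𝔭` on the generic hyperplanes with `β_j = 1` IS a conjugate `β_σ` of the generic
section point.** [cite: NesterenkoPhilippon2001, Ch. 3 Prop. 4.11 (pp. 40–41)] -/
theorem exists_embPt_eq {β : Fin (m + 1) → 𝒢.Om} (hβj : β 𝒢.j = 1)
    (hβI : ∀ P ∈ 𝒢.𝔭, aeval β P = 0)
    (hL : ∀ i : Fin 𝒢.s, ∑ k : Fin (m + 1), algebraMap (RU 𝒢.s m) 𝒢.Om (X (i, k)) * β k = 0) :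
    ∃ σ : 𝒢.L0 →ₐ[𝒢.Kp] 𝒢.Om, β = 𝒢.embPt σ := by
  have hβ0 : β ≠ 0 := fun h => by
    have := congrFun h 𝒢.j
    rw [hβj] at this
    exact one_ne_zero this
  obtain ⟨σ, c, hc⟩ := 𝒢.exists_eq_smul_embPt hβ0 hβI hL
  exact ⟨σ, eq_of_smul_of_apply_eq_one (𝒢.embPt_j σ) hβj hc⟩

/-! ### The norm form -/

/-- `Q(ρ) ∈ 𝕃₀` for a rational polynomial `Q`. [folklore] -/
def QL0 (Q : Rx m) : 𝒢.L0 := aeval 𝒢.rhoL0 Q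

/-- `σ(Q(ρ)) = Q(β_σ)`. [folklore] -/
theorem algHom_QL0 (σ : 𝒢.L0 →ₐ[𝒢.Kp] 𝒢.Om) (Q : Rx m) : σ (𝒢.QL0 Q) = aeval (𝒢.embPt σ) Q := by
  rw [QL0, show σ (aeval 𝒢.rhoL0 Q) = (σ : 𝒢.L0 →+* 𝒢.Om) (aeval 𝒢.rhoL0 Q) from rfl,
    ringHom_aeval_rat]
  rfl

/-- **The norm form** of `Q` (for the exponent `q`, the degree of `Q`):
`G = a^q · N_{𝕃₀/K'}(Q(ρ)) ∈ K' = ℚ(U')`. [cite: NesterenkoPhilippon2001, Ch. 3 Prop. 4.11 (pp. 40–41)] -/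
def normForm (Q : Rx m) (q : ℕ) : 𝒢.Kp :=
  algebraMap (RU 𝒢.s m) 𝒢.Kp (aLead 𝒢.s 𝒢.j (chowForm 𝒢.𝔭 (𝒢.s + 1))) ^ q *
    Algebra.norm 𝒢.Kp (𝒢.QL0 Q)

/-- **The norm form is the product `a^q ∏_σ Q(β_σ)` over the conjugates of the generic section
point** (in `Ω`). [cite: NesterenkoPhilippon2001, Ch. 3 Prop. 4.11 (pp. 40–41)] -/
theorem algebraMap_normForm (Q : Rx m) (q : ℕ) :
    algebraMap 𝒢.Kp 𝒢.Om (𝒢.normForm Q q) =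
      𝒢.aOm ^ q * ∏ σ : 𝒢.L0 →ₐ[𝒢.Kp] 𝒢.Om, aeval (𝒢.embPt σ) Q := by
  rw [normForm, map_mul, map_pow, ← IsScalarTower.algebraMap_apply,
    Algebra.norm_eq_prod_embeddings 𝒢.Kp 𝒢.Om (𝒢.QL0 Q)]
  simp only [algHom_QL0]

/-- A FORM vanishing at the generic section point `ρ` lies in `𝔭` (`ρ = x̄ⱼ⁻¹ ξ`, `ξ` generic).
[folklore] -/
theorem mem_of_aeval_rho_eq_zero {Q : Rx m} {q : ℕ} (hQh : Q.IsHomogeneous q)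
    (h : aeval 𝒢.rho Q = 0) : Q ∈ 𝒢.𝔭 := by
  rw [rho_eq_smul_xi, NesterenkoK.aeval_smul_of_isHomogeneous hQh] at h
  have hc : algebraMap 𝒢.Lp 𝒢.LL (𝒢.xb 𝒢.j)⁻¹ ≠ 0 :=
    (map_ne_zero_iff _ (algebraMap 𝒢.Lp 𝒢.LL).injective).mpr (inv_ne_zero 𝒢.xb_j_ne_zero)
  exact (𝒢.aeval_xi_eq_zero_iff Q).mp ((mul_eq_zero.mp h).resolve_left (pow_ne_zero _ hc))

/-- `Q(β_σ) ≠ 0` for a form `Q ∉ 𝔭`. [folklore] -/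
theorem aeval_embPt_ne_zero {Q : Rx m} {q : ℕ} (hQh : Q.IsHomogeneous q) (hQ : Q ∉ 𝒢.𝔭)
    (σ : 𝒢.L0 →ₐ[𝒢.Kp] 𝒢.Om) : aeval (𝒢.embPt σ) Q ≠ 0 := by
  intro hσ
  apply hQ
  rw [← algHom_QL0, map_eq_zero_iff σ σ.injective, QL0] at hσ
  have h3 : aeval 𝒢.rho Q = 0 := by
    have := congrArg (algebraMap 𝒢.L0 𝒢.LL) hσ
    rwa [ringHom_aeval_rat, map_zero] at this
  exact 𝒢.mem_of_aeval_rho_eq_zero hQh h3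

/-- **The norm form of a form `Q ∉ 𝔭` is non-zero.** [cite: NesterenkoPhilippon2001, Ch. 3 Prop. 4.11 (pp. 40–41)] -/
theorem normForm_ne_zero {Q : Rx m} {q : ℕ} (hQh : Q.IsHomogeneous q) (hQ : Q ∉ 𝒢.𝔭) (q' : ℕ) :
    𝒢.normForm Q q' ≠ 0 := by
  intro h
  have h1 := 𝒢.algebraMap_normForm Q q'
  rw [h, map_zero] at h1
  exact mul_ne_zero (pow_ne_zero _ 𝒢.aOm_ne_zero)
    (Finset.prod_ne_zero_iff.mpr fun σ _ => 𝒢.aeval_embPt_ne_zero hQh hQ σ) h1.symm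

end GSec

end Nesterenko

end Literature.NumberTheory.Transcendental

end
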